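import Literature.NumberTheory.Transcendental.QuadraticRelationsLogarithmsLemma310
import Literature.NumberTheory.Transcendental.QuadraticRelationsLogarithmsProp39
import HarnessLib

/-!
# Roy–Waldschmidt 1997, Théorème 3.2 — part A: the sequence `Qₙ` and the pair lemma (steps of (iv))

Towards **Théorème 3.2** (p. 763) of D. Roy, M. Waldschmidt, *Approximation diophantienne et
indépendance algébrique de logarithmes*, Ann. Sci. ÉNS (4) 30 (1997): "any transcendental
complex number is well approximated by algebraic numbers of large degree and bounded absolute
logarithmic height" — the approximation theorem used (through Théorème 3.1) in the proof of their
Théorème 1.1, whose corollary Théorème 0.2 is the tree's named fact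
`Literature.NumberTheory.Transcendental.royWaldschmidt_quadratic_thm_0_2`.

The printed proof (§3 (iv), pp. 769–771) fixes `κ ≥ 10⁷`, `a = 1/3600`, and for `n` large the
polynomials `Qₙ = Rₙ^{kₙ}` of Proposition 3.9 (`prop_3_9` with `b = 1/18`, `δ = n`, `μ = aκn`):
`deg Qₙ ≤ n`, `log M(Qₙ) ≤ aκn`, `log |Qₙ(θ)| ≤ -aκn²/18`; it then shows that (3.10)
`deg Qₙ ≥ an` and `dist(θ, Z(Qₙ)) ≤ exp(-10⁻⁷κn²)` hold for infinitely many `n`, arguing by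
contradiction from (3.11) in four steps.  The displayed formulas of steps 3)–4) are illegible in
the held scan; the argument is re-derived here with explicit constants (recorded in the seat's
notes) and split into lemmas.  This file: generalities on the sequence (the data
`R, k, α` being arbitrary functions subject to the hypotheses `SeqHyp`, `RootHyp` below, written
out as explicit hypotheses — no definitions) and **step 2**, the pair lemma `pair_step`: for
consecutive indices with non-associated `R_m`, `R_{m+1}`, Lemme 3.10 (`lemme_3_10`, `b = 1/20`)
and (3.11) give (3.12)–(3.13).  No definitions, no named facts.

## References

* [RoyWaldschmidt1997ENS] D. Roy, M. Waldschmidt, Ann. Sci. ÉNS (4) 30 (1997) 753–796, §3 (iv),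
  pp. 769–771 (lit key paper:doi-10-1016-s0012-9593-97-89938-7, PDF pp. 18–20).
-/

noncomputable section

open Polynomial Multiset

namespace Literature.NumberTheory.Transcendental

namespace RoyWaldschmidt1997

/-! ### Generalities on powers of irreducible integer polynomials -/

/-- A non-zero integer polynomial has a value of positive absolute value at a transcendental
number (cf. `Chudnovsky.aeval_ne_zero_of_transcendental`, not imported here to keep the import
closure small). [folklore] -/
theorem norm_aeval_pos_of_transcendental {θ : ℂ} (hθ : Transcendental ℚ θ) {P : ℤ[X]} (hP : P ≠ 0) :
    0 < ‖aeval θ P‖ := by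
  refine norm_pos_iff.mpr fun h0 => ?_
  have h1 : aeval θ (P.map (Int.castRingHom ℚ)) = 0 := by
    rw [← algebraMap_int_eq, aeval_map_algebraMap]; exact h0
  have h2 := (transcendental_iff_injective.mp hθ) (by rw [h1]; simp : aeval θ (P.map (Int.castRingHom ℚ)) = aeval θ 0)
  exact hP ((Polynomial.map_eq_zero_iff (RingHom.injective_int _)).mp h2)

/-- An irreducible integer polynomial some power of which is `< 1` in absolute value at `θ` is
non-constant. [folklore] -/
theorem natDegree_pos_of_pow_small {R : ℤ[X]} (hR : Irreducible R) {k : ℕ} {θ : ℂ}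
    (h : ‖aeval θ (R ^ k)‖ < 1) : 0 < R.natDegree := by
  by_contra hd
  push Not at hd
  have hd0 : R.natDegree = 0 := Nat.le_zero.mp hd
  have h1 := Polynomial.one_le_norm_aeval_of_natDegree_eq_zero hR.ne_zero hd0 θ
  rw [map_pow, norm_pow] at h
  exact absurd (one_le_pow₀ h1 (n := k)) (not_le.mpr h)

/-- Roots of `(R^k)_ℂ` are the roots of `R_ℂ` (as a set), `k ≥ 1`. [folklore] -/
theorem mem_roots_pow_iff {R : ℤ[X]} {k : ℕ} (hk : 0 < k) {z : ℂ} :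
    z ∈ ((R ^ k).map (Int.castRingHom ℂ)).roots ↔ z ∈ (R.map (Int.castRingHom ℂ)).roots := by
  rw [Polynomial.map_pow, roots_pow, Multiset.mem_nsmul]
  exact and_iff_right hk.ne'

/-- Associated integer polynomials differ by a sign. [folklore] -/
theorem eq_or_eq_neg_of_associated {P Q : ℤ[X]} (h : Associated P Q) : Q = P ∨ Q = -P := by
  obtain ⟨u, rfl⟩ := h
  obtain ⟨w, hw, hwu⟩ := Polynomial.isUnit_iff.mp u.isUnit
  rcases Int.isUnit_iff.mp hw with h1 | h1
  · left; rw [← hwu, h1, map_one, mul_one]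
  · right; rw [← hwu, h1, map_neg, map_one, mul_neg, mul_one]

/-- Associated integer polynomials have the same complex roots. [folklore] -/
theorem roots_eq_of_associated {P Q : ℤ[X]} (h : Associated P Q) :
    (Q.map (Int.castRingHom ℂ)).roots = (P.map (Int.castRingHom ℂ)).roots := by
  rcases eq_or_eq_neg_of_associated h with rfl | rfl
  · rfl
  · rw [Polynomial.map_neg, roots_neg]

/-- Associated integer polynomials have the same Mahler measure. [folklore] -/
theorem mahlerMeasure_eq_of_associated {P Q : ℤ[X]} (h : Associated P Q) :
    (Q.map (Int.castRingHom ℂ)).mahlerMeasure = (P.map (Int.castRingHom ℂ)).mahlerMeasure := by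
  rcases eq_or_eq_neg_of_associated h with rfl | rfl
  · rfl
  · rw [Polynomial.map_neg, show -(P.map (Int.castRingHom ℂ)) = C (-1 : ℂ) * P.map (Int.castRingHom ℂ) by simp,
      mahlerMeasure_mul, mahlerMeasure_const, norm_neg, norm_one, one_mul]

/-- Associated integer polynomials have the same degree. [folklore] -/
theorem natDegree_eq_of_associated {P Q : ℤ[X]} (h : Associated P Q) : Q.natDegree = P.natDegree := by
  rcases eq_or_eq_neg_of_associated h with rfl | rfl
  · rfl
  · rw [natDegree_neg]

/-- Non-associated irreducible non-constant integer polynomials have coprime powers over `ℚ`.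
[folklore] -/
theorem isCoprime_pow_of_not_associated {P Q : ℤ[X]} (hP : Irreducible P) (hQ : Irreducible Q)
    (hdP : 0 < P.natDegree) (hdQ : 0 < Q.natDegree) (h : ¬ Associated P Q) (s t : ℕ) :
    IsCoprime ((P ^ s).map (Int.castRingHom ℚ)) ((Q ^ t).map (Int.castRingHom ℚ)) := by
  rw [Polynomial.map_pow, Polynomial.map_pow]
  refine IsCoprime.pow ?_
  by_contra hnc
  exact h (Polynomial.associated_of_not_isCoprime hP hQ hdP hdQ hnc)

/-- `log M(R^k) = k log M(R)` and `log |R^k(θ)| = k log |R(θ)|`. [folklore] -/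
theorem log_mahlerMeasure_pow (R : ℤ[X]) (k : ℕ) :
    Real.log ((R ^ k).map (Int.castRingHom ℂ)).mahlerMeasure =
      k * Real.log (R.map (Int.castRingHom ℂ)).mahlerMeasure := by
  rw [Polynomial.map_pow, ← Real.log_pow]
  congr 1
  induction k with
  | zero => simp
  | succ k ih => rw [pow_succ, mahlerMeasure_mul, ih, pow_succ]

/-! ### Numerical lemmas for the pair lemma -/

/-- `κ(m+1)²/72000 ≤ κt²/64800` for `t ≥ m ≥ 19`. [folklore] -/
theorem pair_num_small {κ m t : ℝ} (hκ : 0 ≤ κ) (hm : 19 ≤ m) (ht : m ≤ t) :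
    κ * (m + 1) ^ 2 / 72000 ≤ κ * t ^ 2 / 64800 := by
  have h1 : 18 * (m + 1) ^ 2 ≤ 20 * m ^ 2 := by nlinarith
  have h2 : m ^ 2 ≤ t ^ 2 := by nlinarith
  have h3 : 18 * (m + 1) ^ 2 ≤ 20 * t ^ 2 := by linarith
  have h4 := mul_le_mul_of_nonneg_left h3 hκ
  rw [div_le_div_iff₀ (by norm_num) (by norm_num)]
  linarith

/-- `κ i²/10⁷ ≤ κ(m+1)²/4320000` for `0 ≤ i ≤ m+1`. [folklore] -/
theorem pair_num_dist {κ m i : ℝ} (hκ : 0 ≤ κ) (hi0 : 0 ≤ i) (hi : i ≤ m + 1) :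
    κ * i ^ 2 / 10 ^ 7 ≤ κ * (m + 1) ^ 2 / 4320000 := by
  have h1 : i ^ 2 ≤ (m + 1) ^ 2 := by nlinarith
  have h2 := mul_le_mul_of_nonneg_left h1 hκ
  rw [div_le_div_iff₀ (by norm_num) (by norm_num)]
  nlinarith

/-! ### The pair lemma (step 2 of (iv)) -/

/-- **Step 2 of the proof of Théorème 3.2** ((3.12)–(3.13), p. 770, with re-derived constants).
Data: a sequence `Qₜ = Rₜ^{kₜ}` (`t ≥ δ₁`) of powers of irreducible integer polynomials with
`deg Qₜ ≤ t`, `log M(Qₜ) ≤ κt/3600`, `|Qₜ(θ)| ≤ exp(-κt²/64800)`, closest roots `αₜ` of `Rₜ`,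
`κ ≥ 3600`; indices `i, j ∈ {m, m+1}` (`m ≥ 19`) with `|θ - αᵢ| ≤ |θ - αⱼ|`, `Qᵢ, Qⱼ` coprime over
`ℚ`, and the negation (3.11) of (3.10) at `i` and at `j`.  Then `deg Qᵢ < i/3600`,
`deg Qⱼ ≥ (m+1)/60`, `log |Qⱼ(θ)| ≥ -3 deg Qⱼ · log M(Qᵢ)`, `|θ - αⱼ| > exp(-10⁻⁷κ(m+1)²)` and
`|θ - αᵢ| ≤ exp(-κ(m+1)²/4320000)` (Lemme 3.10 with `b = 1/20`, `δ = m+1`, `μ = κ(m+1)/3600`).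
[cite: RoyWaldschmidt1997ENS, §3 (iv) step 2, (3.12)–(3.13), p. 770] -/
theorem pair_step (θ : ℂ) (κ : ℝ) (hκ : 3600 ≤ κ) (δ₁ : ℕ) (R : ℕ → ℤ[X]) (k : ℕ → ℕ) (α : ℕ → ℂ)
    (hQ : ∀ t, δ₁ ≤ t → Irreducible (R t) ∧ 0 < k t ∧ (R t ^ k t).natDegree ≤ t ∧
      Real.log ((R t ^ k t).map (Int.castRingHom ℂ)).mahlerMeasure ≤ κ * t / 3600 ∧
      ‖aeval θ (R t ^ k t)‖ ≤ Real.exp (-(κ * t ^ 2 / 64800)))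
    (hα : ∀ t, δ₁ ≤ t → α t ∈ ((R t).map (Int.castRingHom ℂ)).roots ∧
      ∀ β ∈ ((R t).map (Int.castRingHom ℂ)).roots, ‖θ - α t‖ ≤ ‖θ - β‖)
    (i j m : ℕ) (hi : δ₁ ≤ i) (hj : δ₁ ≤ j) (hm : 19 ≤ m) (hmi : m ≤ i) (him : i ≤ m + 1)
    (hmj : m ≤ j) (hjm : j ≤ m + 1) (hD : ‖θ - α i‖ ≤ ‖θ - α j‖)
    (hcop : IsCoprime ((R i ^ k i).map (Int.castRingHom ℚ)) ((R j ^ k j).map (Int.castRingHom ℚ)))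
    (h11i : ¬ ((i : ℝ) / 3600 ≤ (R i ^ k i).natDegree ∧ ‖θ - α i‖ ≤ Real.exp (-(κ * i ^ 2 / 10 ^ 7))))
    (h11j : ¬ ((j : ℝ) / 3600 ≤ (R j ^ k j).natDegree ∧ ‖θ - α j‖ ≤ Real.exp (-(κ * j ^ 2 / 10 ^ 7)))) :
    ((R i ^ k i).natDegree : ℝ) < i / 3600 ∧
    ((m : ℝ) + 1) / 60 ≤ (R j ^ k j).natDegree ∧
    -3 * (R j ^ k j).natDegree * Real.log ((R i ^ k i).map (Int.castRingHom ℂ)).mahlerMeasure ≤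
      Real.log ‖aeval θ (R j ^ k j)‖ ∧
    Real.exp (-(κ * (m + 1) ^ 2 / 10 ^ 7)) < ‖θ - α j‖ ∧
    ‖θ - α i‖ ≤ Real.exp (-(κ * (m + 1) ^ 2 / 4320000)) := by
  obtain ⟨hRi, hki, hdegi, hMi, hsmi⟩ := hQ i hi
  obtain ⟨hRj, hkj, hdegj, hMj, hsmj⟩ := hQ j hj
  obtain ⟨hαi, hαimin⟩ := hα i hi
  obtain ⟨hαj, hαjmin⟩ := hα j hj
  have hκpos : 0 < κ := by linarith
  have hm0 : (0 : ℝ) ≤ m := Nat.cast_nonneg _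
  have him' : (i : ℝ) ≤ m + 1 := by exact_mod_cast him
  have hjm' : (j : ℝ) ≤ m + 1 := by exact_mod_cast hjm
  have hmi' : (m : ℝ) ≤ i := by exact_mod_cast hmi
  have hmj' : (m : ℝ) ≤ j := by exact_mod_cast hmj
  have hm19 : (19 : ℝ) ≤ m := by exact_mod_cast hm
  -- Lemme 3.10 with `b = 1/20`, `δ = m + 1`, `μ = κ (m+1) / 3600`
  set F : ℤ[X] := R i ^ k i with hF
  set G : ℤ[X] := R j ^ k j with hG
  have hF0 : F ≠ 0 := pow_ne_zero _ hRi.ne_zero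
  have hG0 : G ≠ 0 := pow_ne_zero _ hRj.ne_zero
  set μ : ℝ := κ * (m + 1) / 3600 with hμ
  have hδμ : ((m + 1 : ℕ) : ℝ) ≤ μ := by
    rw [hμ]; push_cast
    have : (1 : ℝ) * (m + 1) ≤ κ / 3600 * (m + 1) := mul_le_mul_of_nonneg_right (by linarith) (by linarith)
    linarith
  have hdF : F.natDegree ≤ m + 1 := hdegi.trans him
  have hdG : G.natDegree ≤ m + 1 := hdegj.trans hjm
  have hMF : (F.map (Int.castRingHom ℂ)).mahlerMeasure ≤ Real.exp μ := by
    have hpos : 0 < (F.map (Int.castRingHom ℂ)).mahlerMeasure :=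
      one_pos.trans_le (one_le_mahlerMeasure_of_ne_zero hF0)
    rw [← Real.exp_log hpos]
    refine Real.exp_le_exp.mpr (hMi.trans ?_)
    rw [hμ]; nlinarith
  have hMG : (G.map (Int.castRingHom ℂ)).mahlerMeasure ≤ Real.exp μ := by
    have hpos : 0 < (G.map (Int.castRingHom ℂ)).mahlerMeasure :=
      one_pos.trans_le (one_le_mahlerMeasure_of_ne_zero hG0)
    rw [← Real.exp_log hpos]
    refine Real.exp_le_exp.mpr (hMj.trans ?_)
    rw [hμ]; nlinarith
  -- `α i` is a root of `F_ℂ`, closest among the roots of `F_ℂ` and `G_ℂ`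
  have hα₀ : α i ∈ (F.map (Int.castRingHom ℂ)).roots := (mem_roots_pow_iff hki).mpr hαi
  have hα₀F : ∀ z ∈ (F.map (Int.castRingHom ℂ)).roots, ‖θ - α i‖ ≤ ‖θ - z‖ := fun z hz =>
    hαimin z ((mem_roots_pow_iff hki).mp hz)
  have hα₀G : ∀ z ∈ (G.map (Int.castRingHom ℂ)).roots, ‖θ - α i‖ ≤ ‖θ - z‖ := fun z hz =>
    hD.trans (hαjmin z ((mem_roots_pow_iff hkj).mp hz))
  -- smallness: `κ t²/64800 ≥ (1/20)(m+1) μ = κ (m+1)² / 72000` for `t ≥ m ≥ 19`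
  have hsmallt : ∀ t : ℕ, (m : ℝ) ≤ t → Real.exp (-(κ * t ^ 2 / 64800)) ≤
      Real.exp (-(1 / 20 * ((m + 1 : ℕ) : ℝ) * μ)) := by
    intro t ht
    refine Real.exp_le_exp.mpr ?_
    rw [hμ]; push_cast
    have h3 := pair_num_small hκpos.le hm19 ht
    have : 1 / 20 * ((m : ℝ) + 1) * (κ * (m + 1) / 3600) = κ * ((m : ℝ) + 1) ^ 2 / 72000 := by ring
    rw [this]; linarith
  have hsmall : max ‖aeval θ F‖ ‖aeval θ G‖ ≤ Real.exp (-(1 / 20 * ((m + 1 : ℕ) : ℝ) * μ)) :=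
    max_le (hsmi.trans (hsmallt i hmi')) (hsmj.trans (hsmallt j hmj'))
  obtain ⟨h1, h2, h3⟩ := lemme_3_10 θ (b := 1 / 20) (by norm_num) (by norm_num) (Nat.succ_pos m) hδμ
    F G hF0 hG0 hcop hdF hdG hMF hMG (α i) hα₀ hα₀F hα₀G hsmall
  -- numerical consequences
  have hexp1 : ‖θ - α i‖ ≤ Real.exp (-(κ * i ^ 2 / 10 ^ 7)) := by
    refine h1.trans (Real.exp_le_exp.mpr ?_)
    rw [hμ]; push_cast
    have : (1 / 20) ^ 2 * ((m : ℝ) + 1) * (κ * (m + 1) / 3600) / 3 = κ * ((m : ℝ) + 1) ^ 2 / 4320000 := by ring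
    rw [this]
    have := pair_num_dist hκpos.le (Nat.cast_nonneg i) him'
    linarith
  have hdegi' : ((R i ^ k i).natDegree : ℝ) < i / 3600 := by
    by_contra hc; push Not at hc; exact h11i ⟨hc, hexp1⟩
  have hdegi60 : ((R i ^ k i).natDegree : ℝ) < 1 / 20 * ((m + 1 : ℕ) : ℝ) / 3 := by
    push_cast
    have : (i : ℝ) / 3600 ≤ ((m : ℝ) + 1) / 3600 := div_le_div_of_nonneg_right him' (by norm_num)
    linarith
  have hdegj' : ((m : ℝ) + 1) / 60 ≤ (R j ^ k j).natDegree := by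
    have h2' := h2
    push_cast at h2' hdegi60
    rcases le_max_iff.mp h2' with h | h
    · exfalso; linarith
    · linarith
  have h3' := h3 hdegi60
  refine ⟨hdegi', hdegj', h3', ?_⟩
  -- (3.11) at `j`: the degree alternative fails
  have hdegj11 : (j : ℝ) / 3600 ≤ (R j ^ k j).natDegree := by
    have h60 : (j : ℝ) / 3600 ≤ ((m : ℝ) + 1) / 3600 := div_le_div_of_nonneg_right hjm' (by norm_num)
    have h61 : ((m : ℝ) + 1) / 3600 ≤ ((m : ℝ) + 1) / 60 :=
      div_le_div_of_nonneg_left (by linarith) (by norm_num) (by norm_num)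
    exact (h60.trans h61).trans hdegj'
  have hDj : ¬ ‖θ - α j‖ ≤ Real.exp (-(κ * j ^ 2 / 10 ^ 7)) := fun h => h11j ⟨hdegj11, h⟩
  push Not at hDj
  have h5 : ‖θ - α i‖ ≤ Real.exp (-(κ * (m + 1) ^ 2 / 4320000)) := by
    refine h1.trans (le_of_eq ?_)
    congr 1; rw [hμ]; push_cast; ring
  refine ⟨lt_of_le_of_lt (Real.exp_le_exp.mpr ?_) hDj, h5⟩
  have hj2 : (j : ℝ) ^ 2 ≤ ((m : ℝ) + 1) ^ 2 := by nlinarith [show (0:ℝ) ≤ j from Nat.cast_nonneg _]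
  have := mul_le_mul_of_nonneg_left hj2 hκpos.le
  have : κ * (j : ℝ) ^ 2 / 10 ^ 7 ≤ κ * ((m : ℝ) + 1) ^ 2 / 10 ^ 7 := div_le_div_of_nonneg_right this (by norm_num)
  linarith

end RoyWaldschmidt1997

end Literature.NumberTheory.Transcendental
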